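import Summits.AtomisticToContinuum.HydrodynamicLimit.Theses.BallwiseInvariantReferences
import Summits.AtomisticToContinuum.HydrodynamicLimit.Theorems.MourreKoopmanChargesLinearToEntropyInBandDefs

/-!
# Strategist sketch (cstrat r1) for the crux `BallwiseInvariantReferences.LocalFluxGibbsianity`
(stmt-AtomisticToContinuum-13021) — NEGATION lens.

Typed objects for the negation line "uniaxial-stress witness":

* § 1 the crux restated through the landed vocabulary `Theorems.LTEInBand` (`pressureOf`, …) and the
  verbatim exponent `fullExponent`; `crux_iff` is `Iff.rfl`.
* § 2 the REFUTING-WITNESS SHELL `RefutingWitness P` (the crux's quantifier prefix negated and pushed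
  inside) and the sorry-free composition `not_localFluxGibbsianity_of_witness :
  RefutingWitness (pressureOf fullExponent) → ¬ LocalFluxGibbsianity`.
* § 3 the UNIAXIAL TRACELESS TEST TENSOR `uniax β` (`A_j = c_j e_j`, `c = (−β/2, −β/2, β)`): constant,
  smooth, sup-norm `≤ |β|`, and — the point — its recentring PRESSURE TERM VANISHES identically
  (`∑ j, p̄ · (A j x) j = p̄ · tr = 0`), so the equation of state `hsCompressibility` and the density cap
  `min ρ̄ 2` drop out of the crux's flux for this tensor, while each collision with unit normal `ω`
  contributes `ε |Δ| · β (ω₂² − (ω₀² + ω₁²)/2)` (positive for near-vertical collisions).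
* § 4 the KINEMATIC VIRIAL LEMMA for one piecewise-free flight path confined to a ball of radius `r`:
  `∑ d_k ‖v_k‖² ≤ r (∑ ‖v_{k+1} − v_k‖ + ‖v_n‖)` — confinement + kinetic energy force collisional
  momentum transfer `≥ (energy × time)/r` (PROVED; first rung of the virial floor on caged events).
-/

noncomputable section

open scoped BigOperators Topology InnerProductSpace
open Filter Set MeasureTheory

namespace Summit.AtomisticToContinuum.HydrodynamicLimit.Cruxes.LocalFluxGibbsianity.Strategist

open Summit.AtomisticToContinuum.HydrodynamicLimit.Theorems.LTEInBand
open Summit.AtomisticToContinuum.HydrodynamicLimit.Theses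

/-! ## § 1 The crux through the landed vocabulary -/

/-- The crux's exponent `X = τ⁻¹ [∫₀^τ kin + Σ_coll coll − ∫₀^τ flux]` — VERBATIM the body of
`BallwiseInvariantReferences.LocalFluxGibbsianity` (as in `Cruxes/LocalFluxGibbsianity/Lines/birth.lean`). -/
def fullExponent : ExponentFamily := fun σ' _θ _u ε Φ A₀ A₄ A K L k M z =>
  let τ : ℝ := L * ((M : ℝ) + 1) ^ (-(1 / 3 : ℝ)); let bk : UnitAddTorus (Fin 3) → UnitAddTorus (Fin 3) → ℝ := fun x y => 3 / (Real.pi * (k * ((M : ℝ) + 1) ^ (-(1 / 3 : ℝ))) ^ 3) * max 0 (1 - Literature.Analysis.FluidPDE.Torus.euclidDist x y / (k * ((M : ℝ) + 1) ^ (-(1 / 3 : ℝ)))); let kin : (Fin (M + 1) → UnitAddTorus (Fin 3) × EuclideanSpace ℝ (Fin 3)) → ℝ := fun z => ∑ i, if ‖(z i).2‖ ≤ K then ⟪A₀ (z i).1, (z i).2⟫_ℝ + (∑ j, ⟪A j (z i).1, (z i).2⟫_ℝ * (z i).2 j) + ⟪A₄ (z i).1, (z i).2⟫_ℝ * ‖(z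 i).2‖ ^ 2 / 2 else 0; let coll : (Fin (M + 1) → UnitAddTorus (Fin 3) × EuclideanSpace ℝ (Fin 3)) → (Fin (M + 1) → UnitAddTorus (Fin 3) × EuclideanSpace ℝ (Fin 3)) → ℝ := fun zl zr => ∑ i, (let Δ : EuclideanSpace ℝ (Fin 3) := (zr i).2 - (zl i).2; let ω : EuclideanSpace ℝ (Fin 3) := ‖Δ‖⁻¹ • Δ; if ‖(zl i).2‖ ≤ K ∧ ‖(zr i).2‖ ≤ K then ε M / 2 * ∫ r in (0 : ℝ)..1, ((∑ j, ⟪A j ((zr i).1 + Literature.Analysis.FunctionSpaces.Torus.proj (-(r * ε M) • ω)), ω⟫_ℝ * Δ j) + ⟪A₄ ((zr i).1 + Literature.Analysis.FunctionSpaces.Torus.proj (-(r * ε M) • ω)), ω⟫_ℝ * (‖(zr i).2‖ ^ 2 - ‖(zl i).2‖ ^ 2) / 2) else 0); let flux : (Fin (M + 1) → UnitAddTorus (Fin 3) × EuclideanSpace ℝ (Fin 3)) → ℝ := fun z => ((M : ℝ) + 1) * ∫ x, (let ρ : ℝ := ((M : ℝ) + 1)⁻¹ * ∑ i, (if ‖(z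 i).2‖ ≤ K then bk x (z i).1 else 0); let m : EuclideanSpace ℝ (Fin 3) := ((M : ℝ) + 1)⁻¹ • ∑ i, (if ‖(z i).2‖ ≤ K then bk x (z i).1 • (z i).2 else 0); let e : ℝ := ((M : ℝ) + 1)⁻¹ * ∑ i, (if ‖(z i).2‖ ≤ K then bk x (z i).1 * ‖(z i).2‖ ^ 2 / 2 else 0); let w : EuclideanSpace ℝ (Fin 3) := ρ⁻¹ • m; let p : ℝ := ρ * (2 / 3 * (e / ρ - ‖w‖ ^ 2 / 2)) * Literature.MathematicalPhysics.KineticTheory.hsCompressibility (min ρ 2 * σ' ^ 3); ⟪A₀ x, m⟫_ℝ + (∑ j, (⟪A j x, m⟫_ℝ * w j + p * A j x j)) + ⟪A₄ x, w⟫_ℝ * (e + p)); τ⁻¹ * ((∫ s in (0 : ℝ)..τ, kin ((Φ M).flow s z)) + (∑ᶠ s ∈ Literature.Analysis.FluidPDE.collisionTimes (Literature.Analysis.FluidPDE.Torus.geometry (Fin 3)) (ε M) (fun s => (Φ M).flow s z) ∩ Set.Ioc 0 τ, coll (Function.leftLim (fun s => (Φ M).flow s z) s) ((Φ M).flow s z))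 - ∫ s in (0 : ℝ)..τ, flux ((Φ M).flow s z))

/-- The crux's quantifier shell over a pressure family (order `∀δ ∃K₀ ∀K ∃L₀ ∀L ∃k₀ ∀k`), verbatim. -/
def PressureVanishes (P : PressureFamily) : Prop :=
  ∃ σ₀ : ℝ, 0 < σ₀ ∧ ∀ (σlo σhi θlo θhi U : ℝ), 0 < σlo → σhi < σ₀ → 0 < θlo → ∃ β₀ : ℝ, 0 < β₀ ∧ ∀ σ' ∈ Set.Icc σlo σhi, ∀ θ ∈ Set.Icc θlo θhi, ∀ u : EuclideanSpace ℝ (Fin 3), ‖u‖ ≤ U → ∀ ε : ℕ → ℝ, (∀ M, 0 < ε M) → Filter.Tendsto (fun M : ℕ => ((M : ℝ) + 1) * ε M ^ 3) Filter.atTop (nhds (σ' ^ 3)) → ∀ Φ : (M : ℕ) → Literature.Analysis.FluidPDE.HardSphereFlow (Literature.Analysis.FluidPDE.Torus.geometry (Fin 3)) (ε M) (M + 1), ∀ (A₀ A₄ : UnitAddTorus (Fin 3) → EuclideanSpace ℝ (Fin 3)) (A : Fin 3 → UnitAddTorus (Fin 3) → EuclideanSpace ℝ (Fin 3)), Literature.Analysis.FunctionSpaces.Torus.IsSmooth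 A₀ → Literature.Analysis.FunctionSpaces.Torus.IsSmooth A₄ → (∀ k, Literature.Analysis.FunctionSpaces.Torus.IsSmooth (A k)) → (∀ x, ‖A₀ x‖ ≤ β₀) → (∀ x, ‖A₄ x‖ ≤ β₀) → (∀ k x, ‖A k x‖ ≤ β₀) → ∀ δ : ℝ, 0 < δ → ∃ K₀ : ℝ, ∀ K ≥ K₀, ∃ L₀ : ℝ, ∀ L ≥ L₀, ∃ k₀ : ℝ, ∀ k ≥ k₀, Filter.limsup (fun M : ℕ => P σ' θ u ε Φ A₀ A₄ A K L k M) Filter.atTop ≤ (δ : EReal)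

/-- The crux IS the shell over the full pressure (definitional unfolding). -/
theorem crux_iff :
    BallwiseInvariantReferences.LocalFluxGibbsianity ↔ PressureVanishes (pressureOf fullExponent) :=
  Iff.rfl

/-! ## § 2 The refuting-witness shell and the composition of the negation line -/

/-- **Refuting witness** for a pressure family `P`: for EVERY `σ₀ > 0` an admissible parameter box in
which, for EVERY `β₀ > 0`, some admissible datum (packing `σ'`, temperature `θ`, drift `u`, diameters
`ε`, hard-sphere flows `Φ`, smooth test fields of sup-norm `≤ β₀`) and some `δ > 0` beat the shell:
`∀ K₀ ∃ K ≥ K₀ ∀ L₀ ∃ L ≥ L₀ ∀ k₀ ∃ k ≥ k₀, δ < limsup_M P`.  (The negation of `PressureVanishes P`,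
pushed inside; the uniaxial-stress line instantiates `A₀ = A₄ = 0`, `A = uniax β₀`, `u = 0`.) -/
def RefutingWitness (P : PressureFamily) : Prop :=
  ∀ σ₀ : ℝ, 0 < σ₀ → ∃ σlo σhi θlo θhi U : ℝ, 0 < σlo ∧ σhi < σ₀ ∧ 0 < θlo ∧ ∀ β₀ : ℝ, 0 < β₀ →
    ∃ σ' ∈ Set.Icc σlo σhi, ∃ θ ∈ Set.Icc θlo θhi, ∃ u : EuclideanSpace ℝ (Fin 3), ‖u‖ ≤ U ∧
    ∃ ε : ℕ → ℝ, (∀ M, 0 < ε M) ∧ Filter.Tendsto (fun M : ℕ => ((M : ℝ) + 1) * ε M ^ 3) Filter.atTop (nhds (σ' ^ 3)) ∧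
    ∃ Φ : FlowFamily ε, ∃ (A₀ A₄ : UnitAddTorus (Fin 3) → EuclideanSpace ℝ (Fin 3))
      (A : Fin 3 → UnitAddTorus (Fin 3) → EuclideanSpace ℝ (Fin 3)),
      Literature.Analysis.FunctionSpaces.Torus.IsSmooth A₀ ∧ Literature.Analysis.FunctionSpaces.Torus.IsSmooth A₄ ∧
      (∀ j, Literature.Analysis.FunctionSpaces.Torus.IsSmooth (A j)) ∧ (∀ x, ‖A₀ x‖ ≤ β₀) ∧ (∀ x, ‖A₄ x‖ ≤ β₀) ∧
      (∀ j x, ‖A j x‖ ≤ β₀) ∧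
    ∃ δ : ℝ, 0 < δ ∧ ∀ K₀ : ℝ, ∃ K ≥ K₀, ∀ L₀ : ℝ, ∃ L ≥ L₀, ∀ k₀ : ℝ, ∃ k ≥ k₀,
      (δ : EReal) < Filter.limsup (fun M : ℕ => P σ' θ u ε Φ A₀ A₄ A K L k M) Filter.atTop

/-- A refuting witness negates the shell (pure logic, sorry-free). -/
theorem not_pressureVanishes_of_witness {P : PressureFamily} (hW : RefutingWitness P) :
    ¬ PressureVanishes P := by
  rintro ⟨σ₀, hσ₀, H⟩
  obtain ⟨σlo, σhi, θlo, θhi, U, h1, h2, h3, H'⟩ := hW σ₀ hσ₀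
  obtain ⟨β₀, hβ₀, H⟩ := H σlo σhi θlo θhi U h1 h2 h3
  obtain ⟨σ', hσ', θ, hθ, u, hu, ε, hε, hlim, Φ, A₀, A₄, A, hA₀, hA₄, hA, hb₀, hb₄, hb, δ, hδ, W⟩ :=
    H' β₀ hβ₀
  obtain ⟨K₀, HK⟩ := H σ' hσ' θ hθ u hu ε hε hlim Φ A₀ A₄ A hA₀ hA₄ hA hb₀ hb₄ hb δ hδ
  obtain ⟨K, hK, W⟩ := W K₀
  obtain ⟨L₀, HL⟩ := HK K hK
  obtain ⟨L, hL, W⟩ := W L₀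
  obtain ⟨k₀, Hk⟩ := HL L hL
  obtain ⟨k, hk, W⟩ := W k₀
  exact absurd (Hk k hk) (not_le.mpr W)

/-- **Composition of the negation line**: a refuting witness for the full pressure refutes the crux
BY NAME. -/
theorem not_localFluxGibbsianity_of_witness (hW : RefutingWitness (pressureOf fullExponent)) :
    ¬ BallwiseInvariantReferences.LocalFluxGibbsianity :=
  fun h => not_pressureVanishes_of_witness hW (crux_iff.mp h)

/-! ## § 3 The uniaxial traceless test tensor -/

/-- Diagonal coefficients `c = (−β/2, −β/2, β)` (trace zero). -/
def uniaxCoeff (β : ℝ) (j : Fin 3) : ℝ := if j = 2 then β else -(β / 2)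

/-- The uniaxial traceless test tensor field `A_j(x) = c_j e_j` (constant in `x`). -/
def uniax (β : ℝ) : Fin 3 → UnitAddTorus (Fin 3) → EuclideanSpace ℝ (Fin 3) :=
  fun j _ => EuclideanSpace.single j (uniaxCoeff β j)

theorem uniaxCoeff_sum (β : ℝ) : uniaxCoeff β 0 + uniaxCoeff β 1 + uniaxCoeff β 2 = 0 := by
  simp [uniaxCoeff]; ring

theorem uniax_apply (β : ℝ) (j l : Fin 3) (x : UnitAddTorus (Fin 3)) :
    uniax β j x l = if l = j then uniaxCoeff β j else 0 := by
  simp [uniax, EuclideanSpace.single_apply]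

/-- **The recentring pressure term vanishes for the traceless tensor**: `∑ j, p̄ · (A j x) j = 0`
— so `hsCompressibility` and the cap `min ρ̄ 2` are invisible to this test field. -/
theorem pressure_term_uniax (β p : ℝ) (x : UnitAddTorus (Fin 3)) :
    ∑ j : Fin 3, p * uniax β j x j = 0 := by
  have h : ∀ j : Fin 3, uniax β j x j = uniaxCoeff β j := fun j => by simp [uniax_apply]
  simp only [h, Fin.sum_univ_three, ← mul_add]
  rw [show uniaxCoeff β 0 + uniaxCoeff β 1 + uniaxCoeff β 2 = 0 from uniaxCoeff_sum β, mul_zero]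

/-- Sup-norm of the uniaxial tensor: `‖A_j(x)‖ ≤ |β|`. -/
theorem norm_uniax_le (β : ℝ) (j : Fin 3) (x : UnitAddTorus (Fin 3)) : ‖uniax β j x‖ ≤ |β| := by
  have : ‖uniax β j x‖ = |uniaxCoeff β j| := by
    simp [uniax, EuclideanSpace.norm_single, Real.norm_eq_abs]
  rw [this, uniaxCoeff]
  split_ifs
  · exact le_rfl
  · rw [abs_neg, abs_div, abs_two]
    linarith [abs_nonneg β]

/-- The uniaxial tensor field is smooth (it is constant). -/
theorem isSmooth_uniax (β : ℝ) (j : Fin 3) : Literature.Analysis.FunctionSpaces.Torus.IsSmooth (uniax β j) :=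
  Literature.Analysis.FunctionSpaces.Torus.isSmooth_const _

/-- **Per-collision gain of the traceless tensor**: for a momentum transfer `Δ = c • ω`,
`∑ j ⟪A_j, ω⟫ Δ_j = c · β · (ω₂² − (ω₀² + ω₁²)/2)` — positive for near-vertical unit normals,
`−cβ/2 ·(…)` for horizontal ones; no density or equation-of-state factor. -/
theorem collision_gain_uniax (β c : ℝ) (y : UnitAddTorus (Fin 3)) (ω : EuclideanSpace ℝ (Fin 3)) :
    ∑ j : Fin 3, ⟪uniax β j y, ω⟫_ℝ * (c • ω) j =
      c * β * (ω 2 ^ 2 - (ω 0 ^ 2 + ω 1 ^ 2) / 2) := by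
  simp only [uniax, EuclideanSpace.inner_single_left, Fin.sum_univ_three, PiLp.smul_apply, smul_eq_mul,
    uniaxCoeff]
  simp
  ring

/-! ## § 4 The kinematic virial lemma (one confined piecewise-free path) -/

variable {E : Type*} [NormedAddCommGroup E] [InnerProductSpace ℝ E]

/-- **Flight-virial identity.**  A path made of free flights `x_{k+1} = x_k + d_k v_k` satisfies
`∑_{k ≤ n} d_k ‖v_k‖² + ∑_{k < n} ⟪x_{k+1} − x_0, v_{k+1} − v_k⟫ = ⟪x_{n+1} − x_0, v_n⟫`
(discrete `d/dt ⟪x − x₀, v⟫ = ‖v‖²` plus the jumps at the velocity changes). -/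
theorem flight_virial_identity (x v : ℕ → E) (d : ℕ → ℝ) (hstep : ∀ k, x (k + 1) = x k + d k • v k) :
    ∀ n : ℕ, (∑ k ∈ Finset.range (n + 1), d k * ‖v k‖ ^ 2) +
        (∑ k ∈ Finset.range n, ⟪x (k + 1) - x 0, v (k + 1) - v k⟫_ℝ) = ⟪x (n + 1) - x 0, v n⟫_ℝ := by
  intro n
  induction n with
  | zero =>
    simp [hstep 0, real_inner_smul_left, real_inner_self_eq_norm_sq]
  | succ n ih =>
    simp only [Finset.sum_range_succ] at ih ⊢
    have e1 : ⟪x (n + 1 + 1) - x 0, v (n + 1)⟫_ℝ =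
        ⟪x (n + 1) - x 0, v (n + 1)⟫_ℝ + d (n + 1) * ‖v (n + 1)‖ ^ 2 := by
      rw [hstep (n + 1), add_sub_right_comm, inner_add_left, real_inner_smul_left,
        real_inner_self_eq_norm_sq]
    have e2 : ⟪x (n + 1) - x 0, v (n + 1) - v n⟫_ℝ =
        ⟪x (n + 1) - x 0, v (n + 1)⟫_ℝ - ⟪x (n + 1) - x 0, v n⟫_ℝ := inner_sub_right _ _ _
    rw [e1, e2]
    linarith [ih]

/-- **Kinematic virial lemma.**  If the path stays in the ball of radius `r` about its starting point
(`‖x_k − x_0‖ ≤ r` for `k ≤ n+1`), then the total "kinetic action" is paid for by momentum transfer: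
`∑_{k ≤ n} d_k ‖v_k‖² ≤ r (∑_{k<n} ‖v_{k+1} − v_k‖ + ‖v_n‖)`.  For a caged hard sphere (cage radius
`r = C α' ε`, thermal speed `√θ`, window `τ`) this forces `∑_coll ‖Δ‖ ≳ θ τ /(C α' ε)`, i.e. collisional
virial `ε ∑ ‖Δ‖ ≳ θ τ / (C α')` per particle — the gain side of the uniaxial / jammed witnesses. -/
theorem flight_virial_le (x v : ℕ → E) (d : ℕ → ℝ) (r : ℝ) (n : ℕ)
    (hstep : ∀ k, x (k + 1) = x k + d k • v k) (hconf : ∀ k ≤ n + 1, ‖x k - x 0‖ ≤ r) :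
    ∑ k ∈ Finset.range (n + 1), d k * ‖v k‖ ^ 2 ≤
      r * ((∑ k ∈ Finset.range n, ‖v (k + 1) - v k‖) + ‖v n‖) := by
  have hid := flight_virial_identity x v d hstep n
  have h1 : ⟪x (n + 1) - x 0, v n⟫_ℝ ≤ r * ‖v n‖ :=
    (real_inner_le_norm _ _).trans (mul_le_mul_of_nonneg_right (hconf (n + 1) le_rfl) (norm_nonneg _))
  have h2 : -(r * ∑ k ∈ Finset.range n, ‖v (k + 1) - v k‖) ≤
      ∑ k ∈ Finset.range n, ⟪x (k + 1) - x 0, v (k + 1) - v k⟫_ℝ := by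
    rw [Finset.mul_sum, ← Finset.sum_neg_distrib]
    refine Finset.sum_le_sum fun k hk => ?_
    have hk' : k + 1 ≤ n + 1 := by
      have := Finset.mem_range.mp hk
      omega
    have hcs := abs_real_inner_le_norm (x (k + 1) - x 0) (v (k + 1) - v k)
    have h3 : -⟪x (k + 1) - x 0, v (k + 1) - v k⟫_ℝ ≤ ‖x (k + 1) - x 0‖ * ‖v (k + 1) - v k‖ :=
      (neg_le_abs _).trans hcs
    have h4 : ‖x (k + 1) - x 0‖ * ‖v (k + 1) - v k‖ ≤ r * ‖v (k + 1) - v k‖ :=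
      mul_le_mul_of_nonneg_right (hconf (k + 1) hk') (norm_nonneg _)
    linarith
  rw [mul_add]
  linarith [hid, h1, h2]

end Summit.AtomisticToContinuum.HydrodynamicLimit.Cruxes.LocalFluxGibbsianity.Strategist

end
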